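import Summits.AtomisticToContinuum.HydrodynamicLimit.Theorems.AntiMazurCoboundariesCorrectorPressureDecayKiferCanonicalLocalLimit
import Summits.AtomisticToContinuum.HydrodynamicLimit.Theorems.AntiMazurCoboundariesCorrectorPressureDecayTangentTightnessLaplace
import Summits.AtomisticToContinuum.HydrodynamicLimit.Theorems.AntiMazurCoboundariesCorrectorPressureDecayKiferEntropyLsc
import Literature.Analysis.FunctionSpaces.PoissonPointProcessUniqueness

/-!
# The canonical local limit, III: local limits of x-averaged blow-ups are translation invariant (line `FirstLemma`, crux stmt-AtomisticToContinuum-14135)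

Helper file of the registered stub `stub_georgiiCanonicalLocalLimit : Georgii1995_hardSphereCanonicalLocalLimit`
(Georgii 1995, equivalence of ensembles on the level of measures), namespace
`Summit.AtomisticToContinuum.HydrodynamicLimit.Theorems.KiferCompactification`: the TRANSLATION-INVARIANCE clause of the
compactness half (E1) `CanonicalBlowUpLocallyCompact` (`…KiferCanonicalLocalLimit.lean`) is not an extra requirement — every
setwise local limit of the x-averaged blown-up laws is translation invariant (`isTranslationInvariant_of_isCanonicalLocalLimit`).

* `generateFrom_localEvents`, `ext_of_windowLaw_centredBox`: the local events `windowRestrict (centredBox n) ⁻¹' B` form a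
  π-system generating the σ-algebra of configurations of `ℝ³ × ℝ³` (a count `N(s)` is the supremum of the counts
  `N(s ∩ Λ_n × ℝ³)`), so a finite law is determined by its window laws on the centred cubes;
* `windowRestrict_translate`: windows of translates are translates of windows of the shifted window;
* `blowUpPoint_add_eq` / `windowRestrict_translate_blowUp` (the SEAM LEMMA FOR CONFIGURATIONS): on a window inside the ball
  of radius `R`, translating the blow-up `blowUp ε x z` by `(a, 0)` is EXACTLY blowing up around the shifted base point
  `x - proj (ε a)`, as soon as `2ε(R + ‖a‖) < 1` — for every torus configuration `z`;
* `windowLaw_map_translate_blowUp`: hence, by invariance of Haar measure under the shift of the base point, the window laws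
  of the translate BY `(a,0)` of the x-averaged blow-up `(dx ⊗ Q) ∘ (blowUp ε)⁻¹` of ANY law `Q` agree with those of the
  x-averaged blow-up itself on such windows (no symmetry of `Q` needed);
* `isTranslationInvariant_of_isCanonicalLocalLimit`: passing to the limit along `N k → ∞` (`ε_{N k} → 0`) on the shifted
  windows and using the determination by window laws.

References: H.-O. Georgii, J. Stat. Phys. 80 (1995) §3 (spatial averaging); S. Olla, S. R. S. Varadhan, H.-T. Yau,
Comm. Math. Phys. 155 (1993) Lemma 4.1 (limit points of the averaged blow-ups are translation invariant).
-/

noncomputable section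

open MeasureTheory Set Filter Topology Function Metric
open scoped ENNReal NNReal

namespace Summit.AtomisticToContinuum.HydrodynamicLimit.Theorems.KiferCompactification

open Literature.MathematicalPhysics.KineticTheory (T3 V3 hsDiameter hsDiameter_pos localGibbsLaw blowUpPoint blowUp
  isProbabilityMeasure_localGibbsLaw)
open Literature.MathematicalPhysics.KineticTheory.PointProcess (windowLaw windowRestrict centredBox
  measurable_windowRestrict)
open Literature.Analysis.FluidPDE (HardSphereFlow Config IsTranslationInvariant)
open Literature.Analysis.FunctionSpaces (PointConfig)
open Literature.Analysis.FluidPDE.Torus (reprSym)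
open Literature.Analysis.FunctionSpaces.Torus (proj)

/-! ## Windows, cubes, local events -/

/-- Membership in a window restriction: the point belongs to the configuration and its position to the window. -/
theorem mem_windowRestrict_iff {Λ : Set V3} {ω : PointConfig (V3 × V3)} {p : V3 × V3} :
    p ∈ windowRestrict Λ ω ↔ p ∈ ω ∧ p.1 ∈ Λ :=
  Iff.rfl

/-- Membership in a translate: `p ∈ ω + v ↔ p - v ∈ ω`. -/
theorem mem_translate_iff {v : V3 × V3} {ω : PointConfig (V3 × V3)} {p : V3 × V3} :
    p ∈ ω.translate v ↔ p - v ∈ ω := by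
  change p ∈ (· + v) '' ω.carrier ↔ _
  constructor
  · rintro ⟨q, hq, rfl⟩
    simpa using hq
  · intro h
    exact ⟨p - v, h, sub_add_cancel p v⟩

/-- Points of the centred cube `Λ_n = [-(n+1), n+1)³` have norm at most `2(n+1)`. -/
theorem norm_le_of_mem_centredBox {n : ℕ} {y : V3} (hy : y ∈ centredBox (d := Fin 3) n) :
    ‖y‖ ≤ 2 * ((n : ℝ) + 1) := by
  have hcoord : ∀ i, |y i| ≤ (n : ℝ) + 1 := fun i => by
    have h := hy i
    rw [abs_le]
    exact ⟨h.1, h.2.le⟩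
  have hsum : ∑ i, ‖y i‖ ^ 2 ≤ ∑ _i : Fin 3, ((n : ℝ) + 1) ^ 2 := Finset.sum_le_sum fun i _ => by
    rw [Real.norm_eq_abs]
    exact pow_le_pow_left₀ (abs_nonneg _) (hcoord i) 2
  rw [Finset.sum_const, Finset.card_univ, Fintype.card_fin, nsmul_eq_mul, Nat.cast_ofNat] at hsum
  rw [EuclideanSpace.norm_eq]
  calc Real.sqrt (∑ i, ‖y i‖ ^ 2) ≤ Real.sqrt ((2 * ((n : ℝ) + 1)) ^ 2) :=
        Real.sqrt_le_sqrt (hsum.trans (by nlinarith [sq_nonneg ((n : ℝ) + 1)]))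
    _ = 2 * ((n : ℝ) + 1) := Real.sqrt_sq (by positivity)

/-- The centred cube `Λ_n` lies in the closed ball of radius `2(n+1)`. -/
theorem centredBox_subset_closedBall (n : ℕ) :
    centredBox (d := Fin 3) n ⊆ closedBall (0 : V3) (2 * ((n : ℝ) + 1)) := fun y hy => by
  rw [mem_closedBall, dist_zero_right]
  exact norm_le_of_mem_centredBox hy

/-- The centred cubes are bounded. -/
theorem isBounded_centredBox (n : ℕ) : Bornology.IsBounded (centredBox (d := Fin 3) n) :=
  isBounded_closedBall.subset (centredBox_subset_closedBall n)

/-- The centred cubes are measurable. -/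
theorem measurableSet_centredBox_fin3 (n : ℕ) : MeasurableSet (centredBox (d := Fin 3) n) := by
  have h : centredBox (d := Fin 3) n = ⋂ i, (fun y : V3 => y i) ⁻¹' Ico (-((n : ℝ) + 1)) ((n : ℝ) + 1) := by
    ext y; simp [centredBox]
  rw [h]
  exact MeasurableSet.iInter fun i => measurableSet_Ico.preimage (by fun_prop)

/-- The centred cubes increase. -/
theorem centredBox_mono : Monotone fun n : ℕ => centredBox (d := Fin 3) n := by
  intro m n hmn y hy i
  have h := hy i
  have hc : (m : ℝ) ≤ n := Nat.cast_le.2 hmn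
  constructor <;> linarith [h.1, h.2]

/-- Every point of `ℝ³` lies in some centred cube. -/
theorem exists_mem_centredBox (y : V3) : ∃ n : ℕ, y ∈ centredBox (d := Fin 3) n := by
  obtain ⟨n, hn⟩ := exists_nat_gt ‖y‖
  refine ⟨n, fun i => ?_⟩
  have h : |y i| ≤ ‖y‖ := by simpa using PiLp.norm_apply_le y i
  rw [abs_le] at h
  constructor <;> linarith [h.1, h.2]

/-! ## A finite law on configurations is determined by its window laws on the centred cubes -/

/-- The LOCAL EVENTS (events of the configuration seen in some centred cube) form a π-system. -/
theorem isPiSystem_localEvents :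
    IsPiSystem {A : Set (PointConfig (V3 × V3)) | ∃ (n : ℕ) (B : Set (PointConfig (V3 × V3))),
      MeasurableSet B ∧ A = windowRestrict (centredBox n) ⁻¹' B} := by
  rintro A ⟨n, B, hB, rfl⟩ A' ⟨n', B', hB', rfl⟩ -
  refine ⟨max n n', windowRestrict (centredBox n) ⁻¹' B ∩ windowRestrict (centredBox n') ⁻¹' B',
    (measurable_windowRestrict (measurableSet_centredBox_fin3 n) hB).inter
      (measurable_windowRestrict (measurableSet_centredBox_fin3 n') hB'), ?_⟩
  ext ω
  simp only [mem_inter_iff, mem_preimage]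
  rw [windowRestrict_windowRestrict (centredBox_mono (le_max_left n n')),
    windowRestrict_windowRestrict (centredBox_mono (le_max_right n n'))]

/-- **The local events generate the σ-algebra of configurations**: a count `N(s)` is at least `a` iff some count
`N(s ∩ Λ_m × ℝ³) = N_{window Λ_m}(s)` is. -/
theorem generateFrom_localEvents :
    MeasurableSpace.generateFrom {A : Set (PointConfig (V3 × V3)) | ∃ (n : ℕ) (B : Set (PointConfig (V3 × V3))),
      MeasurableSet B ∧ A = windowRestrict (centredBox n) ⁻¹' B} =
      (PointConfig.instMeasurableSpace : MeasurableSpace (PointConfig (V3 × V3))) := by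
  apply le_antisymm
  · refine MeasurableSpace.generateFrom_le fun A hA => ?_
    obtain ⟨n, B, hB, rfl⟩ := hA
    exact measurable_windowRestrict (measurableSet_centredBox_fin3 n) hB
  · set C := {A : Set (PointConfig (V3 × V3)) | ∃ (n : ℕ) (B : Set (PointConfig (V3 × V3))),
      MeasurableSet B ∧ A = windowRestrict (centredBox n) ⁻¹' B} with hC
    change ⨆ (s : Set (V3 × V3)) (_ : MeasurableSet s),
      (⊤ : MeasurableSpace ℕ∞).comap (fun c : PointConfig (V3 × V3) => c.count s) ≤ _
    refine iSup₂_le fun s hs => ?_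
    rw [← measurable_iff_comap_le]
    -- the events `{a ≤ N(s ∩ Λ_m × ℝ³)}` are local events
    have hG : ∀ (a m : ℕ), MeasurableSet[MeasurableSpace.generateFrom C]
        {c : PointConfig (V3 × V3) | (a : ℕ∞) ≤ c.count (s ∩ Prod.fst ⁻¹' centredBox m)} := by
      intro a m
      refine MeasurableSpace.measurableSet_generateFrom ⟨m, {ω | (a : ℕ∞) ≤ ω.count s}, ?_, ?_⟩
      · exact (show MeasurableSet (Ici (a : ℕ∞)) from MeasurableSet.of_discrete).preimage (PointConfig.measurable_count hs)
      · ext c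
        simp only [mem_setOf_eq, mem_preimage]
        rw [windowRestrict, PointConfig.count_restrict, Set.inter_comm]
    -- hence so are the events `{a ≤ N(s)}`
    have hG' : ∀ a : ℕ, MeasurableSet[MeasurableSpace.generateFrom C]
        {c : PointConfig (V3 × V3) | (a : ℕ∞) ≤ c.count s} := by
      intro a
      have : {c : PointConfig (V3 × V3) | (a : ℕ∞) ≤ c.count s} =
          ⋃ m, {c : PointConfig (V3 × V3) | (a : ℕ∞) ≤ c.count (s ∩ Prod.fst ⁻¹' centredBox m)} := by
        ext c
        simp only [mem_setOf_eq, mem_iUnion]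
        refine c.natCast_le_count_iff_exists s (fun m m' h => preimage_mono (centredBox_mono h)) ?_ a
        exact eq_univ_of_forall fun p => mem_iUnion.2 (exists_mem_centredBox p.1)
      rw [this]
      exact MeasurableSet.iUnion fun m => hG a m
    -- and the level sets `{N(s) = a}`, `a : ℕ`
    refine (@ENat.measurable_iff _ (MeasurableSpace.generateFrom C) _).2 fun a => ?_
    have : (fun c : PointConfig (V3 × V3) => c.count s) ⁻¹' {(a : ℕ∞)} =
        {c : PointConfig (V3 × V3) | (a : ℕ∞) ≤ c.count s} \
          {c : PointConfig (V3 × V3) | ((a + 1 : ℕ) : ℕ∞) ≤ c.count s} := by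
      ext c
      simp only [mem_preimage, mem_singleton_iff, Set.mem_sdiff, mem_setOf_eq, not_le, Nat.cast_add, Nat.cast_one]
      constructor
      · intro hc
        rw [hc]
        exact ⟨le_rfl, ENat.coe_lt_coe.2 (Nat.lt_succ_self a)|>.trans_eq' (by simp)⟩
      · rintro ⟨h1, h2⟩
        exact le_antisymm ((ENat.lt_add_one_iff (ENat.coe_ne_top a)).1 (by simpa using h2)) h1
    rw [this]
    exact (hG' a).diff (hG' (a + 1))

/-- **A finite law on configurations is determined by its window laws on the centred cubes.** -/
theorem ext_of_windowLaw_centredBox {μ ν : Measure (PointConfig (V3 × V3))} [IsFiniteMeasure μ]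
    (h : ∀ n : ℕ, windowLaw (centredBox n) μ = windowLaw (centredBox n) ν) (huniv : μ univ = ν univ) : μ = ν := by
  refine ext_of_generate_finite _ generateFrom_localEvents.symm isPiSystem_localEvents (fun A hA => ?_) huniv
  obtain ⟨n, B, hB, rfl⟩ := hA
  have h' := congrArg (fun m : Measure (PointConfig (V3 × V3)) => m B) (h n)
  simp only [Literature.MathematicalPhysics.KineticTheory.PointProcess.windowLaw,
    Measure.map_apply (measurable_windowRestrict (measurableSet_centredBox_fin3 n)) hB] at h'
  exact h'

/-! ## Windows of translates -/

/-- The window `Λ` of the translate `ω + v` is the translate of the window `Λ - v.1` of `ω`. -/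
theorem windowRestrict_translate (Λ : Set V3) (v : V3 × V3) (ω : PointConfig (V3 × V3)) :
    windowRestrict Λ (ω.translate v) = (windowRestrict ((· + v.1) ⁻¹' Λ) ω).translate v := by
  ext p
  rw [mem_windowRestrict_iff, mem_translate_iff, mem_translate_iff, mem_windowRestrict_iff, mem_preimage, Prod.fst_sub,
    sub_add_cancel]

/-- Window laws of a translated law: `(μ ∘ τ_v⁻¹)_Λ = ((μ)_{Λ - v.1}) ∘ τ_v⁻¹`. -/
theorem windowLaw_map_translate {Λ : Set V3} (hΛ : MeasurableSet Λ) (v : V3 × V3) (μ : Measure (PointConfig (V3 × V3))) :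
    windowLaw Λ (μ.map (PointConfig.translate v)) =
      (windowLaw ((· + v.1) ⁻¹' Λ) μ).map (PointConfig.translate v) := by
  have hΛ' : MeasurableSet ((· + v.1) ⁻¹' Λ) := (measurable_add_const v.1) hΛ
  rw [Literature.MathematicalPhysics.KineticTheory.PointProcess.windowLaw,
    Literature.MathematicalPhysics.KineticTheory.PointProcess.windowLaw,
    Measure.map_map (measurable_windowRestrict hΛ) (PointConfig.measurable_translate v),
    Measure.map_map (PointConfig.measurable_translate v) (measurable_windowRestrict hΛ')]
  congr 1
  funext ω
  exact windowRestrict_translate Λ v ω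

/-! ## The seam lemma for configurations -/

/-- **Seam lemma, point form.** For `2ε(R + ‖a‖) < 1`: if the blown-up particle translated by `(a, 0)` or the particle
blown up around the shifted base point `x - proj (ε a)` has position of norm `≤ R`, the two coincide. -/
theorem blowUpPoint_add_eq {ε R : ℝ} (hε : 0 < ε) {a : V3} (hR : 2 * ε * (R + ‖a‖) < 1) (x : T3) (q : T3 × V3)
    (h : ‖(blowUpPoint ε x q + (a, 0)).1‖ ≤ R ∨ ‖(blowUpPoint ε (x - proj (ε • a)) q).1‖ ≤ R) :
    blowUpPoint ε x q + (a, 0) = blowUpPoint ε (x - proj (ε • a)) q := by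
  -- the two candidate positions
  set P : V3 := ε⁻¹ • reprSym (q.1 - x) + a with hP
  set P' : V3 := ε⁻¹ • reprSym (q.1 - x + proj (ε • a)) with hP'
  have hL : blowUpPoint ε x q + (a, 0) = (P, q.2) := by
    simp only [blowUpPoint, Prod.mk_add_mk, add_zero, hP]
  have hR' : blowUpPoint ε (x - proj (ε • a)) q = (P', q.2) := by
    simp only [blowUpPoint, hP', sub_sub_eq_add_sub, sub_add_eq_add_sub]
  rw [hL, hR'] at h ⊢
  simp only at h
  suffices hPP : P = P' by rw [hPP]
  -- test the seam identity on the indicator of the relevant position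
  rcases h with h | h
  · classical
    have key := blowUp_seam hε hR (f := fun p : V3 × V3 => if ‖p.1‖ ≤ R ∧ p.1 = P then (1 : ℝ) else 0)
      (fun p hp => by
        by_contra hc
        exact hp (if_neg fun hh => hc hh.1)) (q.1 - x) q.2
    simp only [← hP, ← hP', h, true_and, if_true] at key
    by_contra hne
    rw [if_neg (fun hh => hne hh.2.symm)] at key
    exact one_ne_zero key
  · classical
    have key := blowUp_seam hε hR (f := fun p : V3 × V3 => if ‖p.1‖ ≤ R ∧ p.1 = P' then (1 : ℝ) else 0)
      (fun p hp => by
        by_contra hc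
        exact hp (if_neg fun hh => hc hh.1)) (q.1 - x) q.2
    simp only [← hP, ← hP', h, true_and, if_true] at key
    by_contra hne
    rw [if_neg (fun hh => hne hh.2)] at key
    exact zero_ne_one key

/-- **Seam lemma for configurations.** For a window `Λ` inside the closed ball of radius `R` and `2ε(R + ‖a‖) < 1`:
the window of the translate by `(a, 0)` of the blow-up of ANY torus configuration `z` around `x` is the window of its
blow-up around the shifted base point `x - proj (ε a)`. -/
theorem windowRestrict_translate_blowUp {ε R : ℝ} (hε : 0 < ε) {a : V3} (hR : 2 * ε * (R + ‖a‖) < 1) {Λ : Set V3}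
    (hΛ : Λ ⊆ closedBall (0 : V3) R) (x : T3) {n : ℕ} (z : Config n (Fin 3) T3) :
    windowRestrict Λ ((blowUp ε x z).translate ((a, 0) : V3 × V3)) =
      windowRestrict Λ (blowUp ε (x - proj (ε • a)) z) := by
  have hnorm : ∀ p : V3 × V3, p.1 ∈ Λ → ‖p.1‖ ≤ R := fun p hp => by
    have := hΛ hp
    rwa [mem_closedBall, dist_zero_right] at this
  ext p
  rw [mem_windowRestrict_iff, mem_windowRestrict_iff, mem_translate_iff,
    Literature.MathematicalPhysics.KineticTheory.mem_blowUp, Literature.MathematicalPhysics.KineticTheory.mem_blowUp]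
  constructor
  · rintro ⟨⟨i, hi⟩, hp⟩
    refine ⟨⟨i, ?_⟩, hp⟩
    have hi' : blowUpPoint ε x (z i) + (a, 0) = p := by rw [hi, sub_add_cancel]
    rw [← blowUpPoint_add_eq hε hR x (z i) (Or.inl (by rw [hi']; exact hnorm p hp)), hi']
  · rintro ⟨⟨i, hi⟩, hp⟩
    refine ⟨⟨i, ?_⟩, hp⟩
    have h := blowUpPoint_add_eq hε hR x (z i) (Or.inr (by rw [hi]; exact hnorm p hp))
    rw [hi] at h
    rw [← h, add_sub_cancel_right]

/-! ## Window laws of translates of the x-averaged blow-ups -/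

/-- **Exact translation invariance of the x-averaged blown-up window laws.** For ANY law `Q` on torus configurations,
a measurable window `Λ` inside the closed ball of radius `R`, and `2ε(R + ‖a‖) < 1`: the window law on `Λ` of the
translate by `(a, 0)` of the x-averaged blow-up `(dx ⊗ Q) ∘ (blowUp ε)⁻¹` equals the window law of the x-averaged
blow-up itself (seam lemma and invariance of Haar measure under the shift `x ↦ x - proj (ε a)` of the base point). -/
theorem windowLaw_map_translate_blowUp {ε R : ℝ} (hε : 0 < ε) {a : V3} (hR : 2 * ε * (R + ‖a‖) < 1) {Λ : Set V3}
    (hΛm : MeasurableSet Λ) (hΛ : Λ ⊆ closedBall (0 : V3) R) {n : ℕ} (Q : Measure (Config n (Fin 3) T3)) [SFinite Q] :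
    windowLaw Λ ((((volume : Measure T3).prod Q).map fun p => blowUp ε p.1 p.2).map
        (PointConfig.translate ((a, 0) : V3 × V3))) =
      windowLaw Λ (((volume : Measure T3).prod Q).map fun p => blowUp ε p.1 p.2) := by
  set s : T3 := proj (ε • a) with hs
  have hT : MeasurePreserving (Prod.map (fun x : T3 => x - s) id) ((volume : Measure T3).prod Q)
      ((volume : Measure T3).prod Q) :=
    (measurePreserving_sub_right volume s).prod (MeasurePreserving.id Q)
  have hW := measurable_windowRestrict (M := V3) hΛm
  have hτ := PointConfig.measurable_translate (E := V3 × V3) ((a, 0) : V3 × V3)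
  have hB := measurable_blowUp ε n
  rw [Literature.MathematicalPhysics.KineticTheory.PointProcess.windowLaw,
    Literature.MathematicalPhysics.KineticTheory.PointProcess.windowLaw, Measure.map_map hW hτ,
    Measure.map_map (hW.comp hτ) hB, Measure.map_map hW hB]
  have hfun : ((windowRestrict Λ ∘ PointConfig.translate ((a, 0) : V3 × V3)) ∘ fun p : T3 × Config n (Fin 3) T3 =>
      blowUp ε p.1 p.2) =
      (windowRestrict Λ ∘ fun p : T3 × Config n (Fin 3) T3 => blowUp ε p.1 p.2) ∘ Prod.map (fun x : T3 => x - s) id := by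
    funext p
    simp only [Function.comp_apply, Prod.map_fst, Prod.map_snd, id_eq]
    rw [windowRestrict_translate_blowUp hε hR hΛ p.1 p.2, hs]
  rw [hfun, ← Measure.map_map (hW.comp hB) hT.measurable, hT.map_eq]

/-! ## Local limits are translation invariant -/

/-- The hard-sphere diameter tends to `0` along sizes tending to infinity. -/
theorem tendsto_hsDiameter_of_tendsto {σ : ℝ} {N : ℕ → ℕ} (hN : Tendsto N atTop atTop) :
    Tendsto (fun k => hsDiameter σ (N k)) atTop (𝓝 0) := by
  have h1 : Tendsto (fun N : ℕ => ((N + 1 : ℕ) : ℝ)) atTop atTop :=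
    tendsto_natCast_atTop_atTop.comp (tendsto_add_atTop_nat 1)
  have h2 := (((tendsto_rpow_neg_atTop (by norm_num : (0 : ℝ) < 1 / 3)).comp h1).const_mul σ).comp hN
  rw [mul_zero] at h2
  exact h2

/-- **Setwise local limits of the x-averaged blown-up canonical laws are translation invariant.** If `G` is a
probability law which is the local limit of `canonicalBlowUpLaw σ a θ u₀ (N k) (Φ k)` along sizes `N k → ∞`
(`0 < σ ≤ 1/2`, `a, θ > 0`), then `G ∘ τ_{(b,0)}⁻¹ = G` for every `b ∈ ℝ³`: on each centred cube the window law of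
`G ∘ τ⁻¹` is the limit of the window laws of the translated finite-`N` laws on the shifted cube, which agree with the
untranslated ones for `N` large (`windowLaw_map_translate_blowUp`), and window laws on the centred cubes determine `G`. -/
theorem isTranslationInvariant_of_isCanonicalLocalLimit {σ a θ : ℝ} {u₀ : V3} (hσ : 0 < σ) (hσ2 : σ ≤ 1 / 2)
    (ha : 0 < a) (hθ : 0 < θ) {N : ℕ → ℕ}
    {Φ : ∀ k, HardSphereFlow (Literature.Analysis.FluidPDE.Torus.geometry (Fin 3)) (hsDiameter σ (N k)) (N k + 1)}
    (hN : Tendsto N atTop atTop) {G : Measure (PointConfig (V3 × V3))} [IsProbabilityMeasure G]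
    (hG : IsCanonicalLocalLimit σ a θ u₀ N Φ G) : IsTranslationInvariant G := by
  intro b
  haveI hQ : ∀ k, IsProbabilityMeasure (localGibbsLaw σ (fun _ => a) (fun _ => u₀) (fun _ => θ) (N k) (Φ k)) :=
    fun k => isProbabilityMeasure_localGibbsLaw (a₀ := fun _ => a) (θ₀ := fun _ => θ) (u₀ := fun _ => u₀)
      continuous_const continuous_const continuous_const (fun _ => ha) (fun _ => hθ) hσ2 (N k) (Φ k)
  haveI : IsProbabilityMeasure (G.map (PointConfig.translate ((b, 0) : V3 × V3))) :=
    Measure.isProbabilityMeasure_map (PointConfig.measurable_translate _).aemeasurable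
  refine ext_of_windowLaw_centredBox (fun m => ?_) (by rw [measure_univ, measure_univ])
  set Λ : Set V3 := centredBox m with hΛ
  have hΛm : MeasurableSet Λ := measurableSet_centredBox_fin3 m
  set Λ' : Set V3 := (· + b) ⁻¹' Λ with hΛ'
  have hΛ'm : MeasurableSet Λ' := (measurable_add_const b) hΛm
  have hΛ'b : Bornology.IsBounded Λ' := by
    rw [isBounded_iff_forall_norm_le]
    refine ⟨2 * ((m : ℝ) + 1) + ‖b‖, fun y hy => ?_⟩
    have h1 : ‖y + b‖ ≤ 2 * ((m : ℝ) + 1) := norm_le_of_mem_centredBox hy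
    calc ‖y‖ = ‖(y + b) - b‖ := by rw [add_sub_cancel_right]
      _ ≤ ‖y + b‖ + ‖b‖ := norm_sub_le _ _
      _ ≤ _ := by linarith
  refine Measure.ext fun B hB => ?_
  -- the window law of the translate of `G` on `Λ` through the shifted window `Λ'`
  have hτ := PointConfig.measurable_translate (E := V3 × V3) ((b, 0) : V3 × V3)
  have hlhs : windowLaw Λ (G.map (PointConfig.translate ((b, 0) : V3 × V3))) B =
      windowLaw Λ' G (PointConfig.translate ((b, 0) : V3 × V3) ⁻¹' B) := by
    rw [windowLaw_map_translate hΛm, Measure.map_apply hτ hB]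
  -- the same identity at finite `N`
  have hfin : ∀ k, windowLaw Λ ((canonicalBlowUpLaw σ a θ u₀ (N k) (Φ k)).map
      (PointConfig.translate ((b, 0) : V3 × V3))) B =
      windowLaw Λ' (canonicalBlowUpLaw σ a θ u₀ (N k) (Φ k)) (PointConfig.translate ((b, 0) : V3 × V3) ⁻¹' B) := by
    intro k
    rw [windowLaw_map_translate hΛm, Measure.map_apply hτ hB]
  -- convergence on the shifted window
  have hconv : Tendsto (fun k => windowLaw Λ ((canonicalBlowUpLaw σ a θ u₀ (N k) (Φ k)).map
      (PointConfig.translate ((b, 0) : V3 × V3))) B) atTop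
      (𝓝 (windowLaw Λ (G.map (PointConfig.translate ((b, 0) : V3 × V3))) B)) := by
    rw [hlhs]
    simp_rw [hfin]
    exact hG Λ' hΛ'm hΛ'b _ (hτ hB)
  -- for `N` large the translated and untranslated window laws agree
  have hev : ∀ᶠ k in atTop, 2 * hsDiameter σ (N k) * (2 * ((m : ℝ) + 1) + ‖b‖) < 1 := by
    have h : Tendsto (fun k => 2 * hsDiameter σ (N k) * (2 * ((m : ℝ) + 1) + ‖b‖)) atTop
        (𝓝 (2 * 0 * (2 * ((m : ℝ) + 1) + ‖b‖))) :=
      ((tendsto_hsDiameter_of_tendsto hN).const_mul 2).mul_const _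
    rw [mul_zero, zero_mul] at h
    exact h.eventually (gt_mem_nhds one_pos)
  have hconv' : Tendsto (fun k => windowLaw Λ ((canonicalBlowUpLaw σ a θ u₀ (N k) (Φ k)).map
      (PointConfig.translate ((b, 0) : V3 × V3))) B) atTop (𝓝 (windowLaw Λ G B)) := by
    refine (hG Λ hΛm (isBounded_centredBox m) B hB).congr' ?_
    filter_upwards [hev] with k hk
    rw [canonicalBlowUpLaw, windowLaw_map_translate_blowUp (hsDiameter_pos hσ _) hk hΛm
      (centredBox_subset_closedBall m)]
  exact tendsto_nhds_unique hconv hconv'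

/-- The translation-invariance clause of (E1) restated for the x-averaged blown-up canonical laws of the named fact:
any probability law which is the setwise local limit, along sizes `N k → ∞`, of the laws
`(dx ⊗ localGibbsLaw σ a u₀ θ (N k) (Φ k)) ∘ (blowUp ε_{N k})⁻¹` is translation invariant. -/
theorem isTranslationInvariant_of_localLimit : ∀ (σ a θ : ℝ) (u₀ : V3), 0 < σ → σ ≤ 1 / 2 → 0 < a → 0 < θ →
    ∀ (N : ℕ → ℕ)
      (Φ : ∀ k, HardSphereFlow (Literature.Analysis.FluidPDE.Torus.geometry (Fin 3)) (hsDiameter σ (N k)) (N k + 1)),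
      Tendsto N atTop atTop → ∀ (G : Measure (PointConfig (V3 × V3))), IsProbabilityMeasure G →
      (∀ Λ : Set V3, MeasurableSet Λ → Bornology.IsBounded Λ → ∀ A : Set (PointConfig (V3 × V3)), MeasurableSet A →
        Tendsto (fun k => windowLaw Λ
            (((volume : Measure T3).prod
              (localGibbsLaw σ (fun _ => a) (fun _ => u₀) (fun _ => θ) (N k) (Φ k))).map
              (fun p => blowUp (hsDiameter σ (N k)) p.1 p.2)) A)
          atTop (𝓝 (windowLaw Λ G A))) →
      IsTranslationInvariant G := by
  intro σ a θ u₀ hσ hσ2 ha hθ N Φ hN G hGP hloc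
  exact isTranslationInvariant_of_isCanonicalLocalLimit hσ hσ2 ha hθ hN (isCanonicalLocalLimit_iff.2 hloc)

end Summit.AtomisticToContinuum.HydrodynamicLimit.Theorems.KiferCompactification

end
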